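import Mathlib
import HarnessLib
import Literature.MathematicalPhysics.StatisticalMechanics.PolymerNorms
import Summits.HubbardSuperconductivity.HubbardSuperconductivity.Theorems.ComplexGFFStiffnessHypACumulantHolomorphicTaylorNorm
import Summits.HubbardSuperconductivity.HubbardSuperconductivity.Theorems.ComplexGFFStiffnessHypACumulantHolomorphicFamiliesFinite

/-!
# Crux `HypACumulant`, line `gnv` — Taylor-norm and polymer-norm Lipschitz / parallelogram bounds along
# holomorphic families of `C^{r₀}` functionals (the smoothness actually available in the RG)

Route `route-HubbardSuperconductivity-ComplexGFFStiffness`, cruxes stmt-HubbardSuperconductivity-19154 /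
-19155, shared research statement `OnePointLipschitz`, census (C3d′).  The files
`…HolomorphicTaylorNorm` / `…HolomorphicPolymerNorm` assume joint `C^∞`; the activities of [ABKM19] are
`C^{r₀}` in the field (Def. 13.7), which is exactly enough: the Taylor norm of order `r₀` involves the
coefficients `D^s`, `s ≤ r₀`, and by `…HolomorphicFamiliesFinite` these are holomorphic in the parameter
for a jointly `C^{r₀}` family.  This file restates all six bounds under joint `C^{r₀}`:
`tayNorm_sub_le_of_holomorphic_of_contDiff`, `tayNorm_secondDiff_le_of_holomorphic_of_contDiff`,
`tayNormLE_…_of_contDiff`, `weakNormLE_…_of_contDiff`, `midNormLE_…_of_contDiff`.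
Pure bookkeeping; all proved, no `sorry`.

## References
* S. Adams, S. Buchholz, R. Kotecký, S. Müller, arXiv:1910.13564, Definition 13.7, (6.46)–(6.50)
  [AdamsBuchholzKoteckyMuller2019].
-/

noncomputable section

-- `Summit.<Summit>.<Problem>`: single-conjunct summit, the duplicate component is mandated (D-0017).
set_option linter.dupNamespace false

namespace Summit.HubbardSuperconductivity.HubbardSuperconductivity.Theorems.ComplexGFF

open Metric Set Finset
open Literature.MathematicalPhysics.StatisticalMechanics.GradientRG
open Literature.MathematicalPhysics.StatisticalMechanics.TorusPolymer (IsPolymer)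
open Literature.Barriers.CriticalPhenomena.LongRangePhi4.Polymer (IsConn)

section Taylor

variable {E V : Type*} [NormedAddCommGroup E] [NormedSpace ℝ E] [FiniteDimensional ℝ E]
  [NormedAddCommGroup V] [NormedSpace ℝ V]

/-- **Lipschitz bound of the Taylor norm along a holomorphic family.**  `K : ℂ → E → ℂ` jointly `C^∞`,
`σ ↦ K σ ψ` holomorphic on the disc `|σ| < R` for every field `ψ`, and `‖K σ‖_{T_φ} ≤ M` on the disc:
then `‖K σ − K 0‖_{T_φ} ≤ (r₀+1)·(2M/R)·|σ|`. -/
theorem tayNorm_sub_le_of_holomorphic_of_contDiff (T : E →ₗ[ℝ] V) (r₀ : ℕ) {K : ℂ → E → ℂ} {R M : ℝ}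
    (hK : ContDiff ℝ (r₀ : WithTop ℕ∞) (fun p : ℂ × E => K p.1 p.2))
    (hhol : ∀ ψ : E, DifferentiableOn ℂ (fun σ => K σ ψ) (ball (0 : ℂ) R))
    (φ : E) (hM : ∀ σ ∈ ball (0 : ℂ) R, tayNorm T r₀ (K σ) φ ≤ M) {σ : ℂ} (hσ : σ ∈ ball (0 : ℂ) R) :
    tayNorm T r₀ (fun ψ => K σ ψ - K 0 ψ) φ ≤ ((r₀ : ℝ) + 1) * (2 * M / R) * ‖σ‖ := by
  have hR : 0 < R := lt_of_le_of_lt (norm_nonneg σ) (mem_ball_zero_iff.mp hσ)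
  have h0 : (0 : ℂ) ∈ ball (0 : ℂ) R := mem_ball_self hR
  have hM0 : 0 ≤ M := le_trans (tayNorm_nonneg T r₀ (K 0) φ) (hM 0 h0)
  -- the lifted family `F(σ, w) = K σ (section w)` is jointly smooth and holomorphic in `σ`
  set F : ℂ × LinearMap.range T → ℂ := fun p => K p.1 (gaugeSection T p.2) with hF
  have hFs : ContDiff ℝ (r₀ : WithTop ℕ∞) F :=
    hK.comp (contDiff_fst.prodMk ((gaugeSectionCLM T).contDiff.comp contDiff_snd))
  have hFh : ∀ w : LinearMap.range T, DifferentiableOn ℂ (fun σ => F (σ, w)) (ball (0 : ℂ) R) := fun w => by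
    simpa [hF] using hhol (gaugeSection T w)
  have hlift : ∀ σ : ℂ, gaugeLift T (K σ) = fun w => F (σ, w) := fun σ => rfl
  have hKσ : ∀ σ : ℂ, ContDiff ℝ (r₀ : WithTop ℕ∞) (gaugeLift T (K σ)) := fun σ => by
    rw [hlift]; exact hFs.comp ((contDiff_const (c := σ)).prodMk contDiff_id)
  set w₀ : LinearMap.range T := T.rangeRestrict φ with hw₀
  -- each Taylor coefficient: holomorphic in `σ`, bounded by `s!·M·Π‖v_i‖`, hence Lipschitz (Schwarz)
  have hcoef : ∀ s : ℕ, s ≤ r₀ → ∀ v : Fin s → LinearMap.range T,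
      ‖iteratedFDeriv ℝ s (gaugeLift T (K σ)) w₀ v - iteratedFDeriv ℝ s (gaugeLift T (K 0)) w₀ v‖
        ≤ 2 * ((s.factorial : ℝ) * M * ∏ i, ‖v i‖) / R * ‖σ‖ := by
    intro s hs v
    obtain ⟨-, hhol_s⟩ := differentiableOn_iteratedFDeriv_apply_of_holomorphic_of_contDiff isOpen_ball hFs hFh s hs v
    have hd : DifferentiableOn ℂ (fun σ' => iteratedFDeriv ℝ s (fun w => F (σ', w)) w₀ v) (ball (0 : ℂ) R) := hhol_s w₀
    have hb : ∀ σ' ∈ ball (0 : ℂ) R, ‖iteratedFDeriv ℝ s (fun w => F (σ', w)) w₀ v‖ ≤ (s.factorial : ℝ) * M * ∏ i, ‖v i‖ := by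
      intro σ' hσ'
      rw [← hlift]
      calc ‖iteratedFDeriv ℝ s (gaugeLift T (K σ')) w₀ v‖
          ≤ ‖iteratedFDeriv ℝ s (gaugeLift T (K σ')) w₀‖ * ∏ i, ‖v i‖ := ContinuousMultilinearMap.le_opNorm _ _
        _ ≤ ((s.factorial : ℝ) * tayNorm T r₀ (K σ') φ) * ∏ i, ‖v i‖ :=
            mul_le_mul_of_nonneg_right (norm_iteratedFDeriv_gaugeLift_le_factorial_mul_tayNorm T r₀ (K σ') φ hs)
              (Finset.prod_nonneg fun i _ => norm_nonneg _)
        _ ≤ ((s.factorial : ℝ) * M) * ∏ i, ‖v i‖ :=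
            mul_le_mul_of_nonneg_right (mul_le_mul_of_nonneg_left (hM σ' hσ') (Nat.cast_nonneg _))
              (Finset.prod_nonneg fun i _ => norm_nonneg _)
    have h := norm_sub_le_of_bound_ball hd hb hσ
    rw [← hlift, ← hlift] at h
    exact h
  -- the operator norms of the coefficients of the difference
  have hop : ∀ s : ℕ, s ≤ r₀ →
      ‖iteratedFDeriv ℝ s (gaugeLift T (fun ψ => K σ ψ - K 0 ψ)) w₀‖ ≤ 2 * ((s.factorial : ℝ) * M) / R * ‖σ‖ := by
    intro s hs
    have e : gaugeLift T (fun ψ => K σ ψ - K 0 ψ) = gaugeLift T (K σ) - gaugeLift T (K 0) := rfl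
    have hs' : (s : WithTop ℕ∞) ≤ (r₀ : WithTop ℕ∞) := by exact_mod_cast hs
    rw [e, iteratedFDeriv_sub_apply ((hKσ σ).of_le hs').contDiffAt ((hKσ 0).of_le hs').contDiffAt]
    refine ContinuousMultilinearMap.opNorm_le_bound (by positivity) (fun v => ?_)
    rw [sub_apply]
    calc ‖iteratedFDeriv ℝ s (gaugeLift T (K σ)) w₀ v - iteratedFDeriv ℝ s (gaugeLift T (K 0)) w₀ v‖
        ≤ 2 * ((s.factorial : ℝ) * M * ∏ i, ‖v i‖) / R * ‖σ‖ := hcoef s hs v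
      _ = 2 * ((s.factorial : ℝ) * M) / R * ‖σ‖ * ∏ i, ‖v i‖ := by ring
  -- sum over the orders
  unfold tayNorm
  calc ∑ s ∈ Finset.range (r₀ + 1), ((s.factorial : ℝ)⁻¹) * ‖iteratedFDeriv ℝ s (gaugeLift T (fun ψ => K σ ψ - K 0 ψ)) w₀‖
      ≤ ∑ s ∈ Finset.range (r₀ + 1), (2 * M / R * ‖σ‖) := by
        refine Finset.sum_le_sum (fun s hs => ?_)
        have hs' : s ≤ r₀ := Nat.lt_succ_iff.mp (Finset.mem_range.mp hs)
        have hfac : (0 : ℝ) < s.factorial := by exact_mod_cast s.factorial_pos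
        calc ((s.factorial : ℝ)⁻¹) * ‖iteratedFDeriv ℝ s (gaugeLift T (fun ψ => K σ ψ - K 0 ψ)) w₀‖
            ≤ ((s.factorial : ℝ)⁻¹) * (2 * ((s.factorial : ℝ) * M) / R * ‖σ‖) :=
              mul_le_mul_of_nonneg_left (hop s hs') (inv_nonneg.2 hfac.le)
          _ = 2 * M / R * ‖σ‖ := by field_simp
    _ = ((r₀ : ℝ) + 1) * (2 * M / R) * ‖σ‖ := by
        rw [Finset.sum_const, Finset.card_range, nsmul_eq_mul]
        push_cast
        ring

/-- **Parallelogram bound of the Taylor norm along a two-parameter holomorphic family.**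
`K : ℂ → ℂ → E → ℂ` with `(σ, ψ) ↦ K σ τ ψ` and `(τ, ψ) ↦ K σ τ ψ` jointly `C^∞`, separately holomorphic in
`σ` and in `τ` on the bidisc `|σ|, |τ| < R` for every field, and `‖K σ τ‖_{T_φ} ≤ M` there: then
`‖K σ τ − K σ 0 − K 0 τ + K 0 0‖_{T_φ} ≤ (r₀+1)·(4M/R²)·|σ|·|τ|`. -/
theorem tayNorm_secondDiff_le_of_holomorphic_of_contDiff (T : E →ₗ[ℝ] V) (r₀ : ℕ) {K : ℂ → ℂ → E → ℂ} {R M : ℝ}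
    (hKσ : ∀ τ : ℂ, ContDiff ℝ (r₀ : WithTop ℕ∞) (fun p : ℂ × E => K p.1 τ p.2))
    (hKτ : ∀ σ : ℂ, ContDiff ℝ (r₀ : WithTop ℕ∞) (fun p : ℂ × E => K σ p.1 p.2))
    (hholσ : ∀ τ ∈ ball (0 : ℂ) R, ∀ ψ : E, DifferentiableOn ℂ (fun σ => K σ τ ψ) (ball (0 : ℂ) R))
    (hholτ : ∀ σ ∈ ball (0 : ℂ) R, ∀ ψ : E, DifferentiableOn ℂ (fun τ => K σ τ ψ) (ball (0 : ℂ) R))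
    (φ : E) (hM : ∀ σ ∈ ball (0 : ℂ) R, ∀ τ ∈ ball (0 : ℂ) R, tayNorm T r₀ (K σ τ) φ ≤ M)
    {σ τ : ℂ} (hσ : σ ∈ ball (0 : ℂ) R) (hτ : τ ∈ ball (0 : ℂ) R) :
    tayNorm T r₀ (fun ψ => K σ τ ψ - K σ 0 ψ - K 0 τ ψ + K 0 0 ψ) φ
      ≤ ((r₀ : ℝ) + 1) * (4 * M / R ^ 2) * ‖σ‖ * ‖τ‖ := by
  have hR : 0 < R := lt_of_le_of_lt (norm_nonneg σ) (mem_ball_zero_iff.mp hσ)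
  have h0 : (0 : ℂ) ∈ ball (0 : ℂ) R := mem_ball_self hR
  have hM0 : 0 ≤ M := le_trans (tayNorm_nonneg T r₀ (K 0 0) φ) (hM 0 h0 0 h0)
  set w₀ : LinearMap.range T := T.rangeRestrict φ with hw₀
  -- lifted families
  have hlift : ∀ σ τ : ℂ, gaugeLift T (K σ τ) = fun w => K σ τ (gaugeSection T w) := fun σ τ => rfl
  have hFσ : ∀ τ : ℂ, ContDiff ℝ (r₀ : WithTop ℕ∞) (fun p : ℂ × LinearMap.range T => K p.1 τ (gaugeSection T p.2)) :=
    fun τ => (hKσ τ).comp (contDiff_fst.prodMk ((gaugeSectionCLM T).contDiff.comp contDiff_snd))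
  have hFτ : ∀ σ : ℂ, ContDiff ℝ (r₀ : WithTop ℕ∞) (fun p : ℂ × LinearMap.range T => K σ p.1 (gaugeSection T p.2)) :=
    fun σ => (hKτ σ).comp (contDiff_fst.prodMk ((gaugeSectionCLM T).contDiff.comp contDiff_snd))
  have hKc : ∀ σ τ : ℂ, ContDiff ℝ (r₀ : WithTop ℕ∞) (gaugeLift T (K σ τ)) := fun σ τ => by
    rw [hlift]; exact (hFσ τ).comp ((contDiff_const (c := σ)).prodMk contDiff_id)
  -- coefficient-wise bound via the bidisc Schwarz estimate
  have hcoef : ∀ s : ℕ, s ≤ r₀ → ∀ v : Fin s → LinearMap.range T,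
      ‖iteratedFDeriv ℝ s (gaugeLift T (K σ τ)) w₀ v - iteratedFDeriv ℝ s (gaugeLift T (K σ 0)) w₀ v
        - iteratedFDeriv ℝ s (gaugeLift T (K 0 τ)) w₀ v + iteratedFDeriv ℝ s (gaugeLift T (K 0 0)) w₀ v‖
        ≤ 4 * ((s.factorial : ℝ) * M * ∏ i, ‖v i‖) / R ^ 2 * ‖σ‖ * ‖τ‖ := by
    intro s hs v
    set g : ℂ → ℂ → ℂ := fun σ' τ' => iteratedFDeriv ℝ s (gaugeLift T (K σ' τ')) w₀ v with hg
    have hds : ∀ τ' ∈ ball (0 : ℂ) R, DifferentiableOn ℂ (fun σ' => g σ' τ') (ball (0 : ℂ) R) := by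
      intro τ' hτ'
      obtain ⟨-, hh⟩ := differentiableOn_iteratedFDeriv_apply_of_holomorphic_of_contDiff isOpen_ball (hFσ τ')
        (fun w => by simpa using hholσ τ' hτ' (gaugeSection T w)) s hs v
      simpa [hg, hlift] using hh w₀
    have hdt : ∀ σ' ∈ ball (0 : ℂ) R, DifferentiableOn ℂ (g σ') (ball (0 : ℂ) R) := by
      intro σ' hσ'
      obtain ⟨-, hh⟩ := differentiableOn_iteratedFDeriv_apply_of_holomorphic_of_contDiff isOpen_ball (hFτ σ')
        (fun w => by simpa using hholτ σ' hσ' (gaugeSection T w)) s hs v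
      simpa [hg, hlift] using hh w₀
    have hb : ∀ σ' ∈ ball (0 : ℂ) R, ∀ τ' ∈ ball (0 : ℂ) R, ‖g σ' τ'‖ ≤ (s.factorial : ℝ) * M * ∏ i, ‖v i‖ := by
      intro σ' hσ' τ' hτ'
      calc ‖iteratedFDeriv ℝ s (gaugeLift T (K σ' τ')) w₀ v‖
          ≤ ‖iteratedFDeriv ℝ s (gaugeLift T (K σ' τ')) w₀‖ * ∏ i, ‖v i‖ := ContinuousMultilinearMap.le_opNorm _ _
        _ ≤ ((s.factorial : ℝ) * tayNorm T r₀ (K σ' τ') φ) * ∏ i, ‖v i‖ :=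
            mul_le_mul_of_nonneg_right (norm_iteratedFDeriv_gaugeLift_le_factorial_mul_tayNorm T r₀ (K σ' τ') φ hs)
              (Finset.prod_nonneg fun i _ => norm_nonneg _)
        _ ≤ ((s.factorial : ℝ) * M) * ∏ i, ‖v i‖ :=
            mul_le_mul_of_nonneg_right (mul_le_mul_of_nonneg_left (hM σ' hσ' τ' hτ') (Nat.cast_nonneg _))
              (Finset.prod_nonneg fun i _ => norm_nonneg _)
    have h := norm_secondDiff_le_of_bound_bidisc hds hdt hb hσ hτ
    simpa [hg] using h
  have hop : ∀ s : ℕ, s ≤ r₀ →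
      ‖iteratedFDeriv ℝ s (gaugeLift T (fun ψ => K σ τ ψ - K σ 0 ψ - K 0 τ ψ + K 0 0 ψ)) w₀‖
        ≤ 4 * ((s.factorial : ℝ) * M) / R ^ 2 * ‖σ‖ * ‖τ‖ := by
    intro s hs
    have e : gaugeLift T (fun ψ => K σ τ ψ - K σ 0 ψ - K 0 τ ψ + K 0 0 ψ)
        = gaugeLift T (K σ τ) - gaugeLift T (K σ 0) - gaugeLift T (K 0 τ) + gaugeLift T (K 0 0) := rfl
    have hs' : (s : WithTop ℕ∞) ≤ (r₀ : WithTop ℕ∞) := by exact_mod_cast hs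
    have c1 : ContDiffAt ℝ (s : WithTop ℕ∞) (gaugeLift T (K σ τ)) w₀ := ((hKc σ τ).of_le hs').contDiffAt
    have c2 : ContDiffAt ℝ (s : WithTop ℕ∞) (gaugeLift T (K σ 0)) w₀ := ((hKc σ 0).of_le hs').contDiffAt
    have c3 : ContDiffAt ℝ (s : WithTop ℕ∞) (gaugeLift T (K 0 τ)) w₀ := ((hKc 0 τ).of_le hs').contDiffAt
    have c4 : ContDiffAt ℝ (s : WithTop ℕ∞) (gaugeLift T (K 0 0)) w₀ := ((hKc 0 0).of_le hs').contDiffAt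
    have c12 : ContDiffAt ℝ (s : WithTop ℕ∞) (gaugeLift T (K σ τ) - gaugeLift T (K σ 0)) w₀ := c1.sub c2
    have c123 : ContDiffAt ℝ (s : WithTop ℕ∞) (gaugeLift T (K σ τ) - gaugeLift T (K σ 0) - gaugeLift T (K 0 τ)) w₀ :=
      c12.sub c3
    rw [e, iteratedFDeriv_add_apply c123 c4, iteratedFDeriv_sub_apply c12 c3, iteratedFDeriv_sub_apply c1 c2]
    refine ContinuousMultilinearMap.opNorm_le_bound (by positivity) (fun v => ?_)
    simp only [add_apply, sub_apply]
    calc ‖iteratedFDeriv ℝ s (gaugeLift T (K σ τ)) w₀ v - iteratedFDeriv ℝ s (gaugeLift T (K σ 0)) w₀ v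
          - iteratedFDeriv ℝ s (gaugeLift T (K 0 τ)) w₀ v + iteratedFDeriv ℝ s (gaugeLift T (K 0 0)) w₀ v‖
        ≤ 4 * ((s.factorial : ℝ) * M * ∏ i, ‖v i‖) / R ^ 2 * ‖σ‖ * ‖τ‖ := hcoef s hs v
      _ = 4 * ((s.factorial : ℝ) * M) / R ^ 2 * ‖σ‖ * ‖τ‖ * ∏ i, ‖v i‖ := by ring
  unfold tayNorm
  calc ∑ s ∈ Finset.range (r₀ + 1), ((s.factorial : ℝ)⁻¹) *
        ‖iteratedFDeriv ℝ s (gaugeLift T (fun ψ => K σ τ ψ - K σ 0 ψ - K 0 τ ψ + K 0 0 ψ)) w₀‖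
      ≤ ∑ s ∈ Finset.range (r₀ + 1), (4 * M / R ^ 2 * ‖σ‖ * ‖τ‖) := by
        refine Finset.sum_le_sum (fun s hs => ?_)
        have hs' : s ≤ r₀ := Nat.lt_succ_iff.mp (Finset.mem_range.mp hs)
        have hfac : (0 : ℝ) < s.factorial := by exact_mod_cast s.factorial_pos
        calc ((s.factorial : ℝ)⁻¹) *
              ‖iteratedFDeriv ℝ s (gaugeLift T (fun ψ => K σ τ ψ - K σ 0 ψ - K 0 τ ψ + K 0 0 ψ)) w₀‖
            ≤ ((s.factorial : ℝ)⁻¹) * (4 * ((s.factorial : ℝ) * M) / R ^ 2 * ‖σ‖ * ‖τ‖) :=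
              mul_le_mul_of_nonneg_left (hop s hs') (inv_nonneg.2 hfac.le)
          _ = 4 * M / R ^ 2 * ‖σ‖ * ‖τ‖ := by field_simp
    _ = ((r₀ : ℝ) + 1) * (4 * M / R ^ 2) * ‖σ‖ * ‖τ‖ := by
        rw [Finset.sum_const, Finset.card_range, nsmul_eq_mul]
        push_cast
        ring

/-- **`TayNormLE` form of the Lipschitz bound** (weight `w`): a uniform `TayNormLE T r₀ w (K σ) C` on the
disc gives `TayNormLE T r₀ w (K σ − K 0) ((r₀+1)(2C/R)|σ|)`. -/
theorem tayNormLE_sub_of_holomorphic_of_contDiff (T : E →ₗ[ℝ] V) (r₀ : ℕ) (w : E → ℝ) {K : ℂ → E → ℂ} {R C : ℝ}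
    (hK : ContDiff ℝ (r₀ : WithTop ℕ∞) (fun p : ℂ × E => K p.1 p.2))
    (hhol : ∀ ψ : E, DifferentiableOn ℂ (fun σ => K σ ψ) (ball (0 : ℂ) R))
    (hC : ∀ σ ∈ ball (0 : ℂ) R, TayNormLE T r₀ w (K σ) C) {σ : ℂ} (hσ : σ ∈ ball (0 : ℂ) R) :
    TayNormLE T r₀ w (fun ψ => K σ ψ - K 0 ψ) (((r₀ : ℝ) + 1) * (2 * C / R) * ‖σ‖) := by
  intro φ
  have h := tayNorm_sub_le_of_holomorphic_of_contDiff T r₀ hK hhol φ (M := C * w φ) (fun σ' hσ' => hC σ' hσ' φ) hσ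
  calc tayNorm T r₀ (fun ψ => K σ ψ - K 0 ψ) φ ≤ ((r₀ : ℝ) + 1) * (2 * (C * w φ) / R) * ‖σ‖ := h
    _ = ((r₀ : ℝ) + 1) * (2 * C / R) * ‖σ‖ * w φ := by ring

/-- **`TayNormLE` form of the parallelogram bound** (weight `w`). -/
theorem tayNormLE_secondDiff_of_holomorphic_of_contDiff (T : E →ₗ[ℝ] V) (r₀ : ℕ) (w : E → ℝ) {K : ℂ → ℂ → E → ℂ} {R C : ℝ}
    (hKσ : ∀ τ : ℂ, ContDiff ℝ (r₀ : WithTop ℕ∞) (fun p : ℂ × E => K p.1 τ p.2))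
    (hKτ : ∀ σ : ℂ, ContDiff ℝ (r₀ : WithTop ℕ∞) (fun p : ℂ × E => K σ p.1 p.2))
    (hholσ : ∀ τ ∈ ball (0 : ℂ) R, ∀ ψ : E, DifferentiableOn ℂ (fun σ => K σ τ ψ) (ball (0 : ℂ) R))
    (hholτ : ∀ σ ∈ ball (0 : ℂ) R, ∀ ψ : E, DifferentiableOn ℂ (fun τ => K σ τ ψ) (ball (0 : ℂ) R))
    (hC : ∀ σ ∈ ball (0 : ℂ) R, ∀ τ ∈ ball (0 : ℂ) R, TayNormLE T r₀ w (K σ τ) C)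
    {σ τ : ℂ} (hσ : σ ∈ ball (0 : ℂ) R) (hτ : τ ∈ ball (0 : ℂ) R) :
    TayNormLE T r₀ w (fun ψ => K σ τ ψ - K σ 0 ψ - K 0 τ ψ + K 0 0 ψ)
      (((r₀ : ℝ) + 1) * (4 * C / R ^ 2) * ‖σ‖ * ‖τ‖) := by
  intro φ
  have h := tayNorm_secondDiff_le_of_holomorphic_of_contDiff T r₀ hKσ hKτ hholσ hholτ φ (M := C * w φ)
    (fun σ' hσ' τ' hτ' => hC σ' hσ' τ' hτ' φ) hσ hτ
  calc tayNorm T r₀ (fun ψ => K σ τ ψ - K σ 0 ψ - K 0 τ ψ + K 0 0 ψ) φ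
      ≤ ((r₀ : ℝ) + 1) * (4 * (C * w φ) / R ^ 2) * ‖σ‖ * ‖τ‖ := h
    _ = ((r₀ : ℝ) + 1) * (4 * C / R ^ 2) * ‖σ‖ * ‖τ‖ * w φ := by ring


end Taylor

section Polymer

variable {d M : ℕ} [NeZero M]

/-- **Lipschitz bound of the weak polymer norm along a holomorphic family of activities.** -/
theorem weakNormLE_sub_of_holomorphic_of_contDiff (P : NormParams d M) (k : ℕ)
    {K : ℂ → Finset (Fin d → ZMod M) → ((Fin d → ZMod M) → ℝ) → ℂ} {R C : ℝ}
    (hK : ∀ X, ContDiff ℝ (P.r₀ : WithTop ℕ∞) (fun p : ℂ × ((Fin d → ZMod M) → ℝ) => K p.1 X p.2))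
    (hhol : ∀ X ψ, DifferentiableOn ℂ (fun σ => K σ X ψ) (ball (0 : ℂ) R))
    (hC : ∀ σ ∈ ball (0 : ℂ) R, WeakNormLE P k (K σ) C) {σ : ℂ} (hσ : σ ∈ ball (0 : ℂ) R) :
    WeakNormLE P k (fun X ψ => K σ X ψ - K 0 X ψ) (((P.r₀ : ℝ) + 1) * (2 * C / R) * ‖σ‖) := by
  intro X hX hXc
  have h := tayNormLE_sub_of_holomorphic_of_contDiff (P.gauge k X) P.r₀ (P.W.weight k X) (K := fun σ ψ => K σ X ψ)
    (C := C * P.aFactor k X) (hK X) (hhol X) (fun σ' hσ' => hC σ' hσ' X hX hXc) hσ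
  have e : ((P.r₀ : ℝ) + 1) * (2 * (C * P.aFactor k X) / R) * ‖σ‖
      = ((P.r₀ : ℝ) + 1) * (2 * C / R) * ‖σ‖ * P.aFactor k X := by ring
  rw [e] at h
  exact h

/-- **Parallelogram bound of the weak polymer norm along a two-parameter holomorphic family.** -/
theorem weakNormLE_secondDiff_of_holomorphic_of_contDiff (P : NormParams d M) (k : ℕ)
    {K : ℂ → ℂ → Finset (Fin d → ZMod M) → ((Fin d → ZMod M) → ℝ) → ℂ} {R C : ℝ}
    (hKσ : ∀ τ X, ContDiff ℝ (P.r₀ : WithTop ℕ∞) (fun p : ℂ × ((Fin d → ZMod M) → ℝ) => K p.1 τ X p.2))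
    (hKτ : ∀ σ X, ContDiff ℝ (P.r₀ : WithTop ℕ∞) (fun p : ℂ × ((Fin d → ZMod M) → ℝ) => K σ p.1 X p.2))
    (hholσ : ∀ τ ∈ ball (0 : ℂ) R, ∀ X ψ, DifferentiableOn ℂ (fun σ => K σ τ X ψ) (ball (0 : ℂ) R))
    (hholτ : ∀ σ ∈ ball (0 : ℂ) R, ∀ X ψ, DifferentiableOn ℂ (fun τ => K σ τ X ψ) (ball (0 : ℂ) R))
    (hC : ∀ σ ∈ ball (0 : ℂ) R, ∀ τ ∈ ball (0 : ℂ) R, WeakNormLE P k (K σ τ) C)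
    {σ τ : ℂ} (hσ : σ ∈ ball (0 : ℂ) R) (hτ : τ ∈ ball (0 : ℂ) R) :
    WeakNormLE P k (fun X ψ => K σ τ X ψ - K σ 0 X ψ - K 0 τ X ψ + K 0 0 X ψ)
      (((P.r₀ : ℝ) + 1) * (4 * C / R ^ 2) * ‖σ‖ * ‖τ‖) := by
  intro X hX hXc
  have h := tayNormLE_secondDiff_of_holomorphic_of_contDiff (P.gauge k X) P.r₀ (P.W.weight k X) (K := fun σ τ ψ => K σ τ X ψ)
    (C := C * P.aFactor k X) (fun τ' => hKσ τ' X) (fun σ' => hKτ σ' X)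
    (fun τ' hτ' ψ => hholσ τ' hτ' X ψ) (fun σ' hσ' ψ => hholτ σ' hσ' X ψ)
    (fun σ' hσ' τ' hτ' => hC σ' hσ' τ' hτ' X hX hXc) hσ hτ
  have e : ((P.r₀ : ℝ) + 1) * (4 * (C * P.aFactor k X) / R ^ 2) * ‖σ‖ * ‖τ‖
      = ((P.r₀ : ℝ) + 1) * (4 * C / R ^ 2) * ‖σ‖ * ‖τ‖ * P.aFactor k X := by ring
  rw [e] at h
  exact h

/-- **Lipschitz bound of the intermediate polymer norm `‖·‖_{k:k+1}` along a holomorphic family.** -/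
theorem midNormLE_sub_of_holomorphic_of_contDiff (P : NormParams d M) (k : ℕ)
    {K : ℂ → Finset (Fin d → ZMod M) → ((Fin d → ZMod M) → ℝ) → ℂ} {R C : ℝ}
    (hK : ∀ X, ContDiff ℝ (P.r₀ : WithTop ℕ∞) (fun p : ℂ × ((Fin d → ZMod M) → ℝ) => K p.1 X p.2))
    (hhol : ∀ X ψ, DifferentiableOn ℂ (fun σ => K σ X ψ) (ball (0 : ℂ) R))
    (hC : ∀ σ ∈ ball (0 : ℂ) R, MidNormLE P k (K σ) C) {σ : ℂ} (hσ : σ ∈ ball (0 : ℂ) R) :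
    MidNormLE P k (fun X ψ => K σ X ψ - K 0 X ψ) (((P.r₀ : ℝ) + 1) * (2 * C / R) * ‖σ‖) := by
  intro X hX hXc
  have h := tayNormLE_sub_of_holomorphic_of_contDiff (P.gauge k X) P.r₀ (P.W.midWeight k X) (K := fun σ ψ => K σ X ψ)
    (C := C * P.aFactor k X) (hK X) (hhol X) (fun σ' hσ' => hC σ' hσ' X hX hXc) hσ
  have e : ((P.r₀ : ℝ) + 1) * (2 * (C * P.aFactor k X) / R) * ‖σ‖
      = ((P.r₀ : ℝ) + 1) * (2 * C / R) * ‖σ‖ * P.aFactor k X := by ring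
  rw [e] at h
  exact h

/-- **Parallelogram bound of the intermediate polymer norm along a two-parameter holomorphic family.** -/
theorem midNormLE_secondDiff_of_holomorphic_of_contDiff (P : NormParams d M) (k : ℕ)
    {K : ℂ → ℂ → Finset (Fin d → ZMod M) → ((Fin d → ZMod M) → ℝ) → ℂ} {R C : ℝ}
    (hKσ : ∀ τ X, ContDiff ℝ (P.r₀ : WithTop ℕ∞) (fun p : ℂ × ((Fin d → ZMod M) → ℝ) => K p.1 τ X p.2))
    (hKτ : ∀ σ X, ContDiff ℝ (P.r₀ : WithTop ℕ∞) (fun p : ℂ × ((Fin d → ZMod M) → ℝ) => K σ p.1 X p.2))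
    (hholσ : ∀ τ ∈ ball (0 : ℂ) R, ∀ X ψ, DifferentiableOn ℂ (fun σ => K σ τ X ψ) (ball (0 : ℂ) R))
    (hholτ : ∀ σ ∈ ball (0 : ℂ) R, ∀ X ψ, DifferentiableOn ℂ (fun τ => K σ τ X ψ) (ball (0 : ℂ) R))
    (hC : ∀ σ ∈ ball (0 : ℂ) R, ∀ τ ∈ ball (0 : ℂ) R, MidNormLE P k (K σ τ) C)
    {σ τ : ℂ} (hσ : σ ∈ ball (0 : ℂ) R) (hτ : τ ∈ ball (0 : ℂ) R) :
    MidNormLE P k (fun X ψ => K σ τ X ψ - K σ 0 X ψ - K 0 τ X ψ + K 0 0 X ψ)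
      (((P.r₀ : ℝ) + 1) * (4 * C / R ^ 2) * ‖σ‖ * ‖τ‖) := by
  intro X hX hXc
  have h := tayNormLE_secondDiff_of_holomorphic_of_contDiff (P.gauge k X) P.r₀ (P.W.midWeight k X) (K := fun σ τ ψ => K σ τ X ψ)
    (C := C * P.aFactor k X) (fun τ' => hKσ τ' X) (fun σ' => hKτ σ' X)
    (fun τ' hτ' ψ => hholσ τ' hτ' X ψ) (fun σ' hσ' ψ => hholτ σ' hσ' X ψ)
    (fun σ' hσ' τ' hτ' => hC σ' hσ' τ' hτ' X hX hXc) hσ hτ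
  have e : ((P.r₀ : ℝ) + 1) * (4 * (C * P.aFactor k X) / R ^ 2) * ‖σ‖ * ‖τ‖
      = ((P.r₀ : ℝ) + 1) * (4 * C / R ^ 2) * ‖σ‖ * ‖τ‖ * P.aFactor k X := by ring
  rw [e] at h
  exact h


end Polymer

end Summit.HubbardSuperconductivity.HubbardSuperconductivity.Theorems.ComplexGFF

end
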